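import Summits.QuantumFields.YangMills.Theses.FlowLineStateSpace

/-! Tenure aid (strategists do not restate): the RECOMMENDED restatement `CurvatureNonGaussianityR` of the crux with the two
hypotheses the deciding theorem already has from `MassiveScalingSequence` — (AF) `Tendsto sch.β atTop atTop` and (GAP)
`∃ Δ > 0, HasLatticeMassGap r sch Δ` — and the re-certified deciding theorem `closesR` (same proof as `closes`, two more arguments).
Both elaborate against the live route file. One-line signature in `NG_R.txt`. -/

namespace Summit.QuantumFields.YangMills.Theses.FlowLineStateSpace.RestateSketch

/-- The recommended restatement (NG with AF and GAP hypotheses). -/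
def CurvatureNonGaussianityR : Prop :=
  open Literature.MathematicalPhysics.QuantumFieldTheory Literature.MathematicalPhysics.QuantumLattice Literature.MathematicalPhysics.AQFT Literature.Probability.LatticeModels in ∀ (G : Type) [Group G] [TopologicalSpace G] [IsTopologicalGroup G] [CompactSpace G], IsCompactSimpleLieGroup G → letI : MeasurableSpace G := borel G; haveI : BorelSpace G := ⟨rfl⟩; ∀ (r : LatticeRep G) (sch : SpeciesScheme (YMSpecies G)), let μ := fun k : ℕ => wilsonMeasure (d := 4) (L := sch.side k) r.ρ (sch.β k); let LS := fun (k n : ℕ) (F : SchwartzMap (Fin n → EuclideanSpace ℝ (Fin 4)) ℂ) => (∫ U, ∑ x : Fin n → ↥(box 4 (sch.L k)), F (fun i => sch.a k • siteToE ↑(x i)) * ∏ i, ((sch.c r.curvature k * sch.a k ^ 4 * (r.curvature.F (configShift (-↑(x i)) (torusLift (sch.side k) U)) - sch.m r.curvature k) : ℝ) : ℂ) ∂μ k); (∀ k : ℕ, sch.m r.curvature k = ∫ U, r.curvature.F (torusLift (sch.side k) U) ∂μ k) → (∃ (s : ℕ) (α β : ℝ), ∀ (n : ℕ) (F : SchwartzMap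 (Fin n → EuclideanSpace ℝ (Fin 4)) ℂ), IsOffDiagonal F → ∀ᶠ k in Filter.atTop, ‖LS k n F‖ ≤ α * (n.factorial : ℝ) ^ β * schwartzNorm (n * s) F) → (∃ (f g : SchwartzMap (Fin 1 → EuclideanSpace ℝ (Fin 4)) ℂ) (H : SchwartzMap (Fin (1 + 1) → EuclideanSpace ℝ (Fin 4)) ℂ), IsTimeOrdered f ∧ IsTimeOrdered g ∧ IsAppendTensorOf H (osAdjoint f) g ∧ ∃ δ : ℝ, 0 < δ ∧ ∀ᶠ k in Filter.atTop, δ ≤ ‖LS k (1 + 1) H‖) → (∃ Δ : ℝ, 0 < Δ ∧ ∀ (n m : ℕ) (F : SchwartzMap (Fin n → EuclideanSpace ℝ (Fin 4)) ℂ) (G' : SchwartzMap (Fin m → EuclideanSpace ℝ (Fin 4)) ℂ), IsTimeOrdered F → IsTimeOrdered G' → ∃ C : ℝ, ∀ v : EuclideanSpace ℝ (Fin 4), 0 ≤ v 0 → ∀ᶠ k in Filter.atTop, ∀ H : SchwartzMap (Fin (n + m) → EuclideanSpace ℝ (Fin 4)) ℂ, IsAppendTensorOf H (osAdjoint F) (translateMulti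 v G') → ‖LS k (n + m) H - LS k n (osAdjoint F) * LS k m G'‖ ≤ C * Real.exp (-Δ * ‖v‖)) → Filter.Tendsto sch.β Filter.atTop Filter.atTop → (∃ Δ : ℝ, 0 < Δ ∧ HasLatticeMassGap r sch Δ) → ∃ (f g h : SchwartzMap (EuclideanSpace ℝ (Fin 4)) ℂ) (F₃ : SchwartzMap (Fin 3 → EuclideanSpace ℝ (Fin 4)) ℂ), IsTensorOf F₃ ![f, g, h] ∧ IsOffDiagonal F₃ ∧ ∃ δ : ℝ, 0 < δ ∧ ∃ᶠ k in Filter.atTop, δ ≤ ‖LS k 3 F₃‖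

/-- The filed crux implies its restatement (restriction). -/
theorem curvatureNonGaussianityR_of_filed (h : CurvatureNonGaussianity) : CurvatureNonGaussianityR := by
  intro G _ _ _ _ hG r sch μ LS hVS hUVB hND hCL _ _
  exact h G hG r sch hVS hUVB hND hCL

/-- The deciding theorem re-certified with the restated crux in place of `CurvatureNonGaussianity`. -/
theorem closesR (hMSS : MassiveScalingSequence) (hNG : CurvatureNonGaussianityR)
    (hROT : RotationRestoration) (hOSL : OSLimitFromUniformBounds) : YangMills := by
  intro G _ _ _ _ hG
  obtain ⟨r, sch, hAF, hVS, hUVB, hND, hCL, hARP, hGAP⟩ := hMSS G hG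
  have hNG' := hNG G hG r sch hVS hUVB hND hCL hAF hGAP
  have hROT' := hROT G hG r sch hVS hUVB hND hCL
  obtain ⟨sch', T, ⟨φ, hφ, hβ⟩, hYM, hNT, hNGs, hGap⟩ :=
    hOSL G hG r sch hVS hUVB hND hCL hARP hGAP hNG' hROT'
  refine ⟨r, sch', T, ?_, hYM, hNT, hNGs, hGap⟩
  have hb : sch'.β = sch.β ∘ φ := funext hβ
  show Filter.Tendsto sch'.β Filter.atTop Filter.atTop
  rw [hb]
  exact hAF.comp hφ

end Summit.QuantumFields.YangMills.Theses.FlowLineStateSpace.RestateSketch
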